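import Summits.BirchSwinnertonDyer.Rank1Residual.O5.ThreeTorsionNormalFormKummer
import HarnessLib

/-!
# The `3`-adic normal form `y² + a₁xy + a₃y = x³`, III: points of the FORMAL GROUP have a CUBE `y`
# (cell `b2b-bsdres`; seat `b2b-bsdres-x11b3-p7` GEN 15, landed GEN 16 as p309913, doc-only restamp
#  GEN 19; companion of the pool TOOL files `O5/ThreeTorsionNormalFormKummer.lean` (p308301) and
#  `O5/ThreeTorsionNormalFormValuation.lean` (p309383), both landed; TOOL, theorems only; the
#  reading — o5-r1 GEN 13's T30.3 "δ(E₁(ℚ₃)) = 0" of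
#  `HOME/b2b-bsdres-o5-r1/gen13/T30-FLAT-KUMMER-NORMAL-FORM.md` — is the O5 lane's, not asserted here)

HONEST FRAMING (cell `b2b-bsdres`, run/shared/lean/b2b/bsd-rank1-residual/, verbatim in every file): the
goal of the cell is to DELETE the COMBINATION-SHAPED residual classes of the Birch–Swinnerton-Dyer formula
for ALL analytic-rank `≤ 1` elliptic curves over `ℚ` — "full BSD formula for every rank `≤ 1` curve in
class `C`" assembled STRICTLY from published theorems — so that the rank-`≤ 1` remainder becomes exactly
the CONSTRUCTION-SHAPED classes, which are TYPED (missing-input `Prop`s), NOT attempted. This is not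
"finishing BSD". Lane CLASS-CLOSURE / teams o5–o6 (O5 OPEN): research routes; census output is
EVIDENCE, never a Literature fact; nothing is booked; no mark of `RESIDUAL-MAP.md` moves. This file:
THEOREMS ONLY (no definition, no named fact, no `@[conjecture]` node, no `sorry`; net named-fact debt
`0`). It proves NOTHING about any elliptic curve, Kodaira symbol, conductor or Selmer group: pure
`3`-adic algebra about the one cubic equation `y² + a₁xy + a₃y = x³` over `ℚ₃`.

## What is proved (all `[folklore]`)

For `a₁, a₃ ∈ ℚ₃` with `‖a₁‖ < 1` (`3 ∣ a₁`) and `‖a₃‖ ≤ 1`, and an affine solution `(x, y)` of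
`y² + a₁xy + a₃y = x³` with `‖x‖ > 1` (non-integral `x` — in the O5 lane's reading, a point of the
formal group `E₁(ℚ₃)` of the `3`-minimal flex normal form):
* `norm_lt_norm_and_norm_pow_eq_of_one_lt_norm`: `‖x‖ < ‖y‖` and `‖x‖³ = ‖y‖²`
  (so `(v₃ x, v₃ y) = (−2n, −3n)`, `n ≥ 1`) — ultrametric bookkeeping on `y · (y + a₁x + a₃) = x³`;
* `norm_sub_one_le_of_one_lt_norm`: `‖x³/y² − 1‖ ≤ 3⁻²`, because `x³/y² − 1 = (a₁x + a₃)/y` and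
  `‖a₁x‖ ≤ 3⁻¹·‖x‖ ≤ 3⁻²·‖y‖`, `‖a₃‖ ≤ 1 ≤ 3⁻³·‖y‖`;
* **`exists_pow_three_eq_of_one_lt_norm`** (T30.3 in coordinates): `y` is a CUBE in `ℚ₃` — by the
  sibling file's `exists_pow_three_eq_of_norm_sub_one_le` (`1 + 9ℤ₃ ⊆ ℚ₃^{×3}`) applied to `x³/y²`,
  and the identity `y = (x³/y²) · (y/x)³`.
The hypothesis `‖a₁‖ < 1` is used only in the last two (with `‖a₁‖ ≤ 1` the first still holds); it is
essential for the cube conclusion: on `y² + xy = x³` (`a₁ = 1`, `a₃ = 0`) the point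
`(x, y) = (4/9, 4/27)` has `‖x‖ = 9 > 1` but `y = 4·3⁻³` is not a cube (`4 ≢ ±1 (mod 9)`) — this
contrary instance is not formalised here.

References: J. H. Silverman, *The Arithmetic of Elliptic Curves*, IV.1.1 (the expansion
`y = −z⁻³(1 + a₁z + …)` behind the reading) and X.4; o5-r1 GEN 13, `T30-FLAT-KUMMER-NORMAL-FORM.md`
§1 T30.3 (THEOREM on paper, census-validated kit j142073; EVIDENCE in the ledger's sense).
-/

noncomputable section

open Padic

namespace Summit.BirchSwinnertonDyer.Rank1Residual.O5.ThreeTorsionNormalForm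

/-- On `y² + a₁xy + a₃y = x³` over `ℚ₃` with `‖a₁‖ ≤ 1`, `‖a₃‖ ≤ 1`: if `‖x‖ > 1` then `‖x‖ < ‖y‖` and
`‖x‖³ = ‖y‖²`.  Ultrametric bookkeeping on `y · (y + a₁x + a₃) = x³`. [folklore] -/
theorem norm_lt_norm_and_norm_pow_eq_of_one_lt_norm {a₁ a₃ x y : ℚ_[3]} (ha₁ : ‖a₁‖ ≤ 1)
    (ha₃ : ‖a₃‖ ≤ 1) (h : y ^ 2 + a₁ * x * y + a₃ * y = x ^ 3) (hx : 1 < ‖x‖) :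
    ‖x‖ < ‖y‖ ∧ ‖x‖ ^ 3 = ‖y‖ ^ 2 := by
  have hx0 : 0 < ‖x‖ := zero_lt_one.trans hx
  have hfac : y * (y + (a₁ * x + a₃)) = x ^ 3 := by linear_combination h
  -- the "tail" `a₁ x + a₃` is at most `‖x‖`
  have hT : ‖a₁ * x + a₃‖ ≤ ‖x‖ := by
    refine (Padic.nonarchimedean _ _).trans (max_le ?_ (ha₃.trans hx.le))
    rw [norm_mul]
    calc ‖a₁‖ * ‖x‖ ≤ 1 * ‖x‖ := by gcongr
      _ = ‖x‖ := one_mul _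
  have hxy : ‖x‖ < ‖y‖ := by
    by_contra hle
    rw [not_lt] at hle
    have hS : ‖y + (a₁ * x + a₃)‖ ≤ ‖x‖ :=
      (Padic.nonarchimedean _ _).trans (max_le hle hT)
    have h3 : ‖x‖ ^ 3 ≤ ‖x‖ * ‖x‖ := by
      rw [← norm_pow, ← hfac, norm_mul]
      exact mul_le_mul hle hS (norm_nonneg _) (norm_nonneg _)
    nlinarith [mul_pos (mul_pos hx0 hx0) (sub_pos.mpr hx)]
  refine ⟨hxy, ?_⟩
  have hlt : ‖a₁ * x + a₃‖ < ‖y‖ := hT.trans_lt hxy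
  have hS : ‖y + (a₁ * x + a₃)‖ = ‖y‖ := by
    rw [Padic.add_eq_max_of_ne (ne_of_gt hlt), max_eq_left hlt.le]
  rw [← norm_pow, ← hfac, norm_mul, hS, sq]

/-- On `y² + a₁xy + a₃y = x³` over `ℚ₃` with `‖a₁‖ < 1` (`3 ∣ a₁`), `‖a₃‖ ≤ 1`: if `‖x‖ > 1` then
`‖x³/y² − 1‖ ≤ 3⁻²`, i.e. `x³/y² ∈ 1 + 9ℤ₃`.  Indeed `x³/y² − 1 = (a₁x + a₃)/y`, `v₃(x) = −2n`,
`v₃(y) = −3n` with `n ≥ 1`, and `v₃(a₁x) − v₃(y) ≥ 1 + n ≥ 2`, `v₃(a₃) − v₃(y) ≥ 3n ≥ 3`. [folklore] -/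
theorem norm_sub_one_le_of_one_lt_norm {a₁ a₃ x y : ℚ_[3]} (ha₁ : ‖a₁‖ < 1) (ha₃ : ‖a₃‖ ≤ 1)
    (h : y ^ 2 + a₁ * x * y + a₃ * y = x ^ 3) (hx : 1 < ‖x‖) :
    ‖x ^ 3 / y ^ 2 - 1‖ ≤ (3 : ℝ) ^ (-2 : ℤ) := by
  obtain ⟨hxy, hpow⟩ := norm_lt_norm_and_norm_pow_eq_of_one_lt_norm ha₁.le ha₃ h hx
  have hx0 : x ≠ 0 := norm_pos_iff.mp (zero_lt_one.trans hx)
  have hy0' : 0 < ‖y‖ := (zero_lt_one.trans hx).trans hxy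
  have hy0 : y ≠ 0 := norm_pos_iff.mp hy0'
  have h3 : (1 : ℝ) < 3 := by norm_num
  -- norms as powers of `3`
  have hnx : ‖x‖ = (3 : ℝ) ^ (-x.valuation) := by
    exact_mod_cast Padic.norm_eq_zpow_neg_valuation hx0
  have hny : ‖y‖ = (3 : ℝ) ^ (-y.valuation) := by
    exact_mod_cast Padic.norm_eq_zpow_neg_valuation hy0
  have hvx : x.valuation < 0 := by
    by_contra hv
    rw [not_lt] at hv
    have : ‖x‖ ≤ 1 := by exact_mod_cast (Padic.norm_le_one_iff_val_nonneg x).mpr hv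
    exact this.not_gt hx
  have hrel : 3 * x.valuation = 2 * y.valuation := by
    rw [hnx, hny, ← zpow_natCast, ← zpow_natCast, ← zpow_mul, ← zpow_mul] at hpow
    have := zpow_right_injective₀ (zero_lt_one.trans h3) h3.ne' hpow
    push_cast at this
    omega
  have ha₁' : ‖a₁‖ ≤ (3 : ℝ) ^ (-1 : ℤ) := by
    have h31 : ‖a₁‖ < ((3 : ℕ) : ℝ) ^ ((-1 : ℤ) + 1) := by
      norm_num
      exact ha₁
    exact_mod_cast (Padic.norm_le_pow_iff_norm_lt_pow_add_one a₁ (-1)).mpr h31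
  -- rewrite `x³/y² − 1 = (a₁ x + a₃)/y`
  have hrew : x ^ 3 / y ^ 2 - 1 = (a₁ * x + a₃) / y := by
    have hy2 : y ^ 2 ≠ 0 := pow_ne_zero _ hy0
    rw [div_sub_one hy2, ← h, div_eq_div_iff hy2 hy0]
    ring
  rw [hrew, norm_div, div_le_iff₀ hy0']
  refine (Padic.nonarchimedean _ _).trans (max_le ?_ ?_)
  · rw [norm_mul, hnx, hny]
    calc ‖a₁‖ * (3 : ℝ) ^ (-x.valuation)
        ≤ (3 : ℝ) ^ (-1 : ℤ) * (3 : ℝ) ^ (-x.valuation) :=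
          mul_le_mul_of_nonneg_right ha₁' (zpow_nonneg (by norm_num) _)
      _ = (3 : ℝ) ^ (-1 + -x.valuation) := (zpow_add₀ three_ne_zero _ _).symm
      _ ≤ (3 : ℝ) ^ (-2 + -y.valuation) := zpow_le_zpow_right₀ h3.le (by omega)
      _ = (3 : ℝ) ^ (-2 : ℤ) * (3 : ℝ) ^ (-y.valuation) := zpow_add₀ three_ne_zero _ _
  · rw [hny]
    calc ‖a₃‖ ≤ 1 := ha₃
      _ = (3 : ℝ) ^ (0 : ℤ) := (zpow_zero _).symm
      _ ≤ (3 : ℝ) ^ (-2 + -y.valuation) := zpow_le_zpow_right₀ h3.le (by omega)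
      _ = (3 : ℝ) ^ (-2 : ℤ) * (3 : ℝ) ^ (-y.valuation) := zpow_add₀ three_ne_zero _ _

/-- **T30.3 in coordinates (the flat part dies).** On `y² + a₁xy + a₃y = x³` over `ℚ₃` with
`‖a₁‖ < 1` (`3 ∣ a₁`) and `‖a₃‖ ≤ 1`, every affine solution with `‖x‖ > 1` has `y ∈ ℚ₃^{×3}`:
`y = (x³/y²)·(y/x)³` and `x³/y² ∈ 1 + 9ℤ₃ ⊆ ℚ₃^{×3}`
(`exists_pow_three_eq_of_norm_sub_one_le`).  In the O5 lane's reading (o5-r1 GEN 13, T30.3): the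
`φ̂`-Kummer value `δ(P) = [y(P)]` of a formal-group point of the flex normal form is trivial,
`δ(E₁(ℚ₃)) = 0` — NOT asserted here. [folklore] -/
theorem exists_pow_three_eq_of_one_lt_norm {a₁ a₃ x y : ℚ_[3]} (ha₁ : ‖a₁‖ < 1) (ha₃ : ‖a₃‖ ≤ 1)
    (h : y ^ 2 + a₁ * x * y + a₃ * y = x ^ 3) (hx : 1 < ‖x‖) : ∃ w : ℚ_[3], y = w ^ 3 := by
  obtain ⟨hxy, -⟩ := norm_lt_norm_and_norm_pow_eq_of_one_lt_norm ha₁.le ha₃ h hx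
  have hx0 : x ≠ 0 := norm_pos_iff.mp (zero_lt_one.trans hx)
  have hy0 : y ≠ 0 := norm_pos_iff.mp ((zero_lt_one.trans hx).trans hxy)
  obtain ⟨c, hc⟩ :=
    exists_pow_three_eq_of_norm_sub_one_le (norm_sub_one_le_of_one_lt_norm ha₁ ha₃ h hx)
  refine ⟨c * (y / x), ?_⟩
  calc y = x ^ 3 / y ^ 2 * (y / x) ^ 3 := by field_simp
    _ = (c * (y / x)) ^ 3 := by rw [hc]; ring

end Summit.BirchSwinnertonDyer.Rank1Residual.O5.ThreeTorsionNormalForm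

end
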